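import Summits.ValiantsHypothesis.ValiantsHypothesis.Theorems.KPlusLogSqLawSymmetricTwoByTwo
import Summits.ValiantsHypothesis.ValiantsHypothesis.Theorems.LacunarySymmetroidMatrixDescartesCensusFrame

/-!
# Route «KPlusLogSqLaw» — the symmetric `(2, K)` tropical family with `3K − 4` alternations, part 1/3: the COST CHAINS
# (toward crux `Lifting`, stmt-ValiantsHypothesis-19772; HOME/val-sym-lift-p4/GAP-LIFT.md §8)

HONEST FRAMING.  Object-search cell `pub-symmetroid`.  Parts 1–3 type a CLOSED-FORM symmetric tropical design of format `(2, K)` whose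
dominant chain has `3K − 3` terms of alternating sign, for every `K ≥ 3` — so the symmetric tropical census at `m = 2` REACHES the lead's
patchwork ceiling `3K − 4` (HOME/lead/PATCHWORK-CEILING.md, where sharpness was computed by LP for `K ≤ 6`) — and, by symmetric patchworking
(`symmDesign_le_of_posRootLawAt`), `ζ₊(2, K) ≥ 3K − 4` for EVERY `K ≥ 3` in one theorem (part 3).  Nothing is asserted about `Lifting`,
`TropicalB`, `KPlusLogSqLaw`, `MatrixDescartes`, the Door-A numeral (the real `(2,K)` column EXCEEDS `3K − 4` by cancellation:
`(2,4) = 9`, `(2,5) = 14` of record) or `VP ≠ VNP`.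

THIS PART.  Abscissae `2^l`; a cost chain `chain s` with `chain s (i+1) − chain s i = s(i+1)·V·2^i` (`V = 8`; the design uses the DOUBLED
costs `2·chain`, i.e. edge slopes `U·s(i)`, `U = 16`); the `(1,1)`-chain `gh` (slopes `U·j`) and the `(0,0)`-chain `ah` (slopes `U·(K+j)`,
all above the `(1,1)`-slopes, so the Minkowski hull of the two letter chains is the L-shaped staircase); the interior diagonal c-point cost
`2·bq l = 2·gh l + U(l+1)(2^l − 1) − 2` (two below the chord from `P_{0,l}` to `P_{0,l+1}` at abscissa `2^{l+1}`), the boundary cost `big`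
and the off-diagonal cost `bo`; the SUPPORTING-SLOPE inequalities of a convex chain (`gpart_*`, `apart_*`: a competitor class above /
below the vertex class loses at least `(slope gap)·(abscissa gap)`), and the c-point bookkeeping (`two_bq_sub_gh_succ`, `bq_le_gh`,
`big_wins`). [folklore]
-/

-- `Summit.ValiantsHypothesis.ValiantsHypothesis.…` repeats a component by the D-0017 layout
-- (single-conjunct summit), which the `dupNamespace` linter flags; the name is mandated.
set_option linter.dupNamespace false
set_option autoImplicit false

namespace Summit.ValiantsHypothesis.ValiantsHypothesis.Theorems.LacunarySymmetroidMatrixDescartes.TropicalCensus.SymTwoK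

open Summit.ValiantsHypothesis.ValiantsHypothesis.Theorems.MatrixDescartes.Negative
open Summit.ValiantsHypothesis.ValiantsHypothesis.Theorems.LacunarySymmetroidMatrixDescartes
open scoped BigOperators
open Finset

/-! ### Convex cost chains on the abscissae `2^l` -/

/-- half the unit slope spacing (`U = 16`, `V = U/2 = 8`). -/
def V : ℤ := 8

/-- a cost chain with edge slopes `2V·s(i)`: `chain s 0 = 0`, `chain s (i+1) = chain s i + s (i+1) · V · 2^i` (this is HALF the cost;
the design uses `2 · chain`). -/
def chain (s : ℕ → ℤ) : ℕ → ℤ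
  | 0 => 0
  | i + 1 => chain s i + s (i + 1) * V * 2 ^ i

/-- `chain_zero` (see the module docstring). [folklore] -/
theorem chain_zero (s : ℕ → ℤ) : chain s 0 = 0 := rfl

/-- `chain_succ` (see the module docstring). [folklore] -/
theorem chain_succ (s : ℕ → ℤ) (i : ℕ) : chain s (i + 1) = chain s i + s (i + 1) * V * 2 ^ i := rfl

/-- lower bound on increments of a chain with monotone slopes: `chain (j+n) − chain j ≥ s(j+1)·V·(2^(j+n) − 2^j)`. -/
theorem chain_sub_ge (s : ℕ → ℤ) (hs : ∀ i i', i ≤ i' → s i ≤ s i') (j n : ℕ) :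
    s (j + 1) * V * (2 ^ (j + n) - 2 ^ j) ≤ chain s (j + n) - chain s j := by
  induction n with
  | zero => simp
  | succ n ih =>
    rw [show j + (n + 1) = (j + n) + 1 by omega, chain_succ]
    have h1 : s (j + 1) ≤ s (j + n + 1) := hs _ _ (by omega)
    have hV : (0 : ℤ) ≤ V := by unfold V; norm_num
    have hp : (0 : ℤ) ≤ 2 ^ (j + n) := by positivity
    have key : s (j + 1) * V * ((2 : ℤ) ^ (j + n + 1) - 2 ^ j)
        = s (j + 1) * V * (2 ^ (j + n) - 2 ^ j) + s (j + 1) * V * 2 ^ (j + n) := by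
      rw [pow_succ]; ring
    have hint : s (j + 1) * V * (2 : ℤ) ^ (j + n) ≤ s (j + n + 1) * V * 2 ^ (j + n) :=
      mul_le_mul_of_nonneg_right (mul_le_mul_of_nonneg_right h1 hV) hp
    rw [key]
    linarith

/-- upper bound on increments: `chain (j+n) − chain j ≤ s(j+n)·V·(2^(j+n) − 2^j)`. -/
theorem chain_sub_le (s : ℕ → ℤ) (hs : ∀ i i', i ≤ i' → s i ≤ s i') (j n : ℕ) :
    chain s (j + n) - chain s j ≤ s (j + n) * V * (2 ^ (j + n) - 2 ^ j) := by
  induction n with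
  | zero => simp
  | succ n ih =>
    rw [show j + (n + 1) = (j + n) + 1 by omega, chain_succ]
    have h1 : s (j + n) ≤ s (j + n + 1) := hs _ _ (by omega)
    have hV : (0 : ℤ) ≤ V := by unfold V; norm_num
    have hpj : (0 : ℤ) ≤ 2 ^ (j + n) - 2 ^ j := sub_nonneg.mpr (pow_le_pow_right₀ (by norm_num) (by omega))
    have key : s (j + n + 1) * V * ((2 : ℤ) ^ (j + n + 1) - 2 ^ j)
        = s (j + n + 1) * V * (2 ^ (j + n) - 2 ^ j) + s (j + n + 1) * V * 2 ^ (j + n) := by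
      rw [pow_succ]; ring
    have hint : s (j + n) * V * ((2 : ℤ) ^ (j + n) - 2 ^ j) ≤ s (j + n + 1) * V * (2 ^ (j + n) - 2 ^ j) :=
      mul_le_mul_of_nonneg_right (mul_le_mul_of_nonneg_right h1 hV) hpj
    rw [key]
    linarith

/-- the chain is nonnegative for nonnegative slopes. -/
theorem chain_nonneg (s : ℕ → ℤ) (hs0 : ∀ i, 0 ≤ s i) (j : ℕ) : 0 ≤ chain s j := by
  induction j with
  | zero => simp [chain_zero]
  | succ j ih =>
    rw [chain_succ]
    have hV : (0 : ℤ) ≤ V := by unfold V; norm_num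
    have : (0 : ℤ) ≤ s (j + 1) * V * 2 ^ j := by have := hs0 (j + 1); positivity
    linarith

/-- **supporting-slope inequality** for a chain with monotone slopes: if `2V·s(j) + 4 ≤ θ ≤ 2V·s(j+1)` hmm — stated with the
doubled cost `2·chain` and an arbitrary `θ`: for `j' ≥ j`, `2(chain j' − chain j) − θ(2^j' − 2^j) ≥ (2V·s(j+1) − θ)(2^j' − 2^j)`. -/
theorem two_chain_sub_ge (s : ℕ → ℤ) (hs : ∀ i i', i ≤ i' → s i ≤ s i') (j n : ℕ) (θ : ℤ) :
    (2 * V * s (j + 1) - θ) * (2 ^ (j + n) - 2 ^ j) ≤ 2 * (chain s (j + n) - chain s j) - θ * (2 ^ (j + n) - 2 ^ j) := by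
  have := chain_sub_ge s hs j n
  nlinarith

/-- `two_chain_sub_le` (see the module docstring). [folklore] -/
theorem two_chain_sub_le (s : ℕ → ℤ) (hs : ∀ i i', i ≤ i' → s i ≤ s i') (j n : ℕ) (θ : ℤ) :
    2 * (chain s (j + n) - chain s j) - θ * (2 ^ (j + n) - 2 ^ j) ≤ (2 * V * s (j + n) - θ) * (2 ^ (j + n) - 2 ^ j) := by
  have := chain_sub_le s hs j n
  nlinarith


/-! ### The costs of the design -/

/-- slopes of the `(1,1)`-chain: `s_G(i) = i` (edge slopes `U·i`, `U = 2V = 16`). -/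
def sG : ℕ → ℤ := fun i => (i : ℤ)

/-- slopes of the `(0,0)`-chain: `s_A(i) = K + i` (all above the `(1,1)`-slopes). -/
def sA (K : ℕ) : ℕ → ℤ := fun i => (K : ℤ) + i

/-- `sG_mono` (see the module docstring). [folklore] -/
theorem sG_mono : ∀ i i' : ℕ, i ≤ i' → sG i ≤ sG i' := fun i i' h => by unfold sG; exact_mod_cast h
/-- `sA_mono` (see the module docstring). [folklore] -/
theorem sA_mono (K : ℕ) : ∀ i i' : ℕ, i ≤ i' → sA K i ≤ sA K i' := fun i i' h => by
  unfold sA; have : (i : ℤ) ≤ i' := by exact_mod_cast h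
  linarith

/-- half the `(1,1)`-cost of class `j`. -/
def gh : ℕ → ℤ := chain sG
/-- half the `(0,0)`-cost of class `i`. -/
def ah (K : ℕ) : ℕ → ℤ := chain (sA K)

/-- half the cost of the interior diagonal c-point `c_l`: `C_l / 2 = gh l + V(l+1)(2^l − 1) − 1` (the c-point sits `2` below the
chord from `P_{0,l}` to `P_{0,l+1}` at abscissa `2^{l+1}`). -/
def bq (l : ℕ) : ℤ := gh l + V * (l + 1) * (2 ^ l - 1) - 1

/-- a cost exceeding every supporting functional (for the two boundary c-points `c_0`, `c_{K−1}`). -/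
def big (K : ℕ) : ℤ := 2 * ah K K + 2 * gh K + (2 * V * (2 * K + 1) + 8) * 2 ^ K + 8

/-- off-diagonal cost of class `l`: `bq l` inside, `big` at `l = 0` and `l ≥ K − 1`. -/
def bo (K : ℕ) (l : ℕ) : ℤ := if 1 ≤ l ∧ l + 2 ≤ K then bq l else big K

/-- `gh_zero` (see the module docstring). [folklore] -/
theorem gh_zero : gh 0 = 0 := rfl
/-- `ah_zero` (see the module docstring). [folklore] -/
theorem ah_zero (K : ℕ) : ah K 0 = 0 := rfl
/-- `gh_succ` (see the module docstring). [folklore] -/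
theorem gh_succ (l : ℕ) : gh (l + 1) = gh l + (l + 1 : ℕ) * V * 2 ^ l := by
  show chain sG (l + 1) = chain sG l + ((l + 1 : ℕ) : ℤ) * V * 2 ^ l
  rw [chain_succ]
  rfl

/-- `gh_nonneg` (see the module docstring). [folklore] -/
theorem gh_nonneg (j : ℕ) : 0 ≤ gh j := chain_nonneg sG (fun i => by unfold sG; positivity) j
/-- `ah_nonneg` (see the module docstring). [folklore] -/
theorem ah_nonneg (K i : ℕ) : 0 ≤ ah K i := chain_nonneg (sA K) (fun i => by unfold sA; positivity) i

/-- `gh_mono` (see the module docstring). [folklore] -/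
theorem gh_mono {j j' : ℕ} (h : j ≤ j') : gh j ≤ gh j' := by
  obtain ⟨n, rfl⟩ := Nat.exists_eq_add_of_le h
  have := chain_sub_ge sG sG_mono j n
  have hs : (0 : ℤ) ≤ sG (j + 1) * V * (2 ^ (j + n) - 2 ^ j) := by
    have h1 : (0 : ℤ) ≤ sG (j + 1) := by unfold sG; positivity
    have h2 : (2 : ℤ) ^ j ≤ 2 ^ (j + n) := pow_le_pow_right₀ (by norm_num) (by omega)
    have hV : (0 : ℤ) ≤ V := by unfold V; norm_num
    exact mul_nonneg (mul_nonneg h1 hV) (sub_nonneg.mpr h2)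
  unfold gh; linarith

/-- `ah_mono` (see the module docstring). [folklore] -/
theorem ah_mono (K : ℕ) {i i' : ℕ} (h : i ≤ i') : ah K i ≤ ah K i' := by
  obtain ⟨n, rfl⟩ := Nat.exists_eq_add_of_le h
  have := chain_sub_ge (sA K) (sA_mono K) i n
  have hs : (0 : ℤ) ≤ sA K (i + 1) * V * (2 ^ (i + n) - 2 ^ i) := by
    have h1 : (0 : ℤ) ≤ sA K (i + 1) := by unfold sA; positivity
    have h2 : (2 : ℤ) ^ i ≤ 2 ^ (i + n) := pow_le_pow_right₀ (by norm_num) (by omega)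
    have hV : (0 : ℤ) ≤ V := by unfold V; norm_num
    exact mul_nonneg (mul_nonneg h1 hV) (sub_nonneg.mpr h2)
  unfold ah; linarith

/-! ### Supporting-slope inequalities for the two chains -/

/-- g-part, competitor class ABOVE the vertex class: `θ ≤ U(j+1)` ⇒ `2(gh j' − gh j) − θ(2^j' − 2^j) ≥ (U(j+1) − θ)(2^j' − 2^j)`. -/
theorem gpart_above (j j' : ℕ) (hjj : j ≤ j') (θ : ℤ) :
    (2 * V * ((j : ℤ) + 1) - θ) * (2 ^ j' - 2 ^ j) ≤ 2 * gh j' - 2 * gh j - θ * (2 ^ j' - 2 ^ j) := by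
  obtain ⟨n, rfl⟩ := Nat.exists_eq_add_of_le hjj
  have h := two_chain_sub_ge sG sG_mono j n θ
  have e : sG (j + 1) = (j : ℤ) + 1 := by unfold sG; push_cast; ring
  rw [e] at h
  unfold gh; linarith

/-- g-part, competitor class BELOW the vertex class: `2(gh j' − gh j) − θ(2^j' − 2^j) ≥ (θ − U j)(2^j − 2^j')` for `j' ≤ j`. -/
theorem gpart_below (j j' : ℕ) (hjj : j' ≤ j) (θ : ℤ) :
    (θ - 2 * V * (j : ℤ)) * (2 ^ j - 2 ^ j') ≤ 2 * gh j' - 2 * gh j - θ * (2 ^ j' - 2 ^ j) := by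
  obtain ⟨n, rfl⟩ := Nat.exists_eq_add_of_le hjj
  have h := two_chain_sub_le sG sG_mono j' n θ
  have e : sG (j' + n) = ((j' + n : ℕ) : ℤ) := by unfold sG; rfl
  rw [e] at h
  unfold gh; push_cast at h ⊢; linarith

/-- a-part, above. -/
theorem apart_above (K i i' : ℕ) (hii : i ≤ i') (θ : ℤ) :
    (2 * V * ((K : ℤ) + i + 1) - θ) * (2 ^ i' - 2 ^ i) ≤ 2 * ah K i' - 2 * ah K i - θ * (2 ^ i' - 2 ^ i) := by
  obtain ⟨n, rfl⟩ := Nat.exists_eq_add_of_le hii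
  have h := two_chain_sub_ge (sA K) (sA_mono K) i n θ
  have e : sA K (i + 1) = (K : ℤ) + i + 1 := by unfold sA; push_cast; ring
  rw [e] at h
  unfold ah; linarith

/-- a-part, below. -/
theorem apart_below (K i i' : ℕ) (hii : i' ≤ i) (θ : ℤ) :
    (θ - 2 * V * ((K : ℤ) + i)) * (2 ^ i - 2 ^ i') ≤ 2 * ah K i' - 2 * ah K i - θ * (2 ^ i' - 2 ^ i) := by
  obtain ⟨n, rfl⟩ := Nat.exists_eq_add_of_le hii
  have h := two_chain_sub_le (sA K) (sA_mono K) i' n θ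
  have e : sA K (i' + n) = (K : ℤ) + ((i' + n : ℕ) : ℤ) := by unfold sA; rfl
  rw [e] at h
  unfold ah; push_cast at h ⊢; linarith

/-- the g-part at a vertex class `j` with `U j ≤ θ ≤ U (j+1)` is nonnegative for every competitor class. -/
theorem gpart_nonneg (j j' : ℕ) (θ : ℤ) (h1 : 2 * V * (j : ℤ) ≤ θ) (h2 : θ ≤ 2 * V * ((j : ℤ) + 1)) :
    0 ≤ 2 * gh j' - 2 * gh j - θ * (2 ^ j' - 2 ^ j) := by
  rcases le_total j j' with h | h
  · have := gpart_above j j' h θ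
    have hp : (0 : ℤ) ≤ 2 ^ j' - 2 ^ j := sub_nonneg.mpr (pow_le_pow_right₀ (by norm_num) h)
    nlinarith [mul_nonneg (sub_nonneg.mpr h2) hp]
  · have := gpart_below j j' h θ
    have hp : (0 : ℤ) ≤ 2 ^ j - 2 ^ j' := sub_nonneg.mpr (pow_le_pow_right₀ (by norm_num) h)
    nlinarith [mul_nonneg (sub_nonneg.mpr h1) hp]

/-- … and positive for a DIFFERENT competitor class when the slope is strictly inside. -/
theorem gpart_pos (j j' : ℕ) (hne : j' ≠ j) (θ : ℤ) (h1 : 2 * V * (j : ℤ) < θ) (h2 : θ < 2 * V * ((j : ℤ) + 1)) :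
    0 < 2 * gh j' - 2 * gh j - θ * (2 ^ j' - 2 ^ j) := by
  rcases Nat.lt_or_gt_of_ne hne with h | h
  · have := gpart_below j j' h.le θ
    have hp : (0 : ℤ) < 2 ^ j - 2 ^ j' := sub_pos.mpr (pow_lt_pow_right₀ (by norm_num) h)
    nlinarith [mul_pos (sub_pos.mpr h1) hp]
  · have := gpart_above j j' h.le θ
    have hp : (0 : ℤ) < 2 ^ j' - 2 ^ j := sub_pos.mpr (pow_lt_pow_right₀ (by norm_num) h)
    nlinarith [mul_pos (sub_pos.mpr h2) hp]

/-- `apart_nonneg` (see the module docstring). [folklore] -/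
theorem apart_nonneg (K i i' : ℕ) (θ : ℤ) (h1 : 2 * V * ((K : ℤ) + i) ≤ θ) (h2 : θ ≤ 2 * V * ((K : ℤ) + i + 1)) :
    0 ≤ 2 * ah K i' - 2 * ah K i - θ * (2 ^ i' - 2 ^ i) := by
  rcases le_total i i' with h | h
  · have := apart_above K i i' h θ
    have hp : (0 : ℤ) ≤ 2 ^ i' - 2 ^ i := sub_nonneg.mpr (pow_le_pow_right₀ (by norm_num) h)
    nlinarith [mul_nonneg (sub_nonneg.mpr h2) hp]
  · have := apart_below K i i' h θ
    have hp : (0 : ℤ) ≤ 2 ^ i - 2 ^ i' := sub_nonneg.mpr (pow_le_pow_right₀ (by norm_num) h)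
    nlinarith [mul_nonneg (sub_nonneg.mpr h1) hp]

/-- `apart_pos` (see the module docstring). [folklore] -/
theorem apart_pos (K i i' : ℕ) (hne : i' ≠ i) (θ : ℤ) (h1 : 2 * V * ((K : ℤ) + i) < θ)
    (h2 : θ < 2 * V * ((K : ℤ) + i + 1)) :
    0 < 2 * ah K i' - 2 * ah K i - θ * (2 ^ i' - 2 ^ i) := by
  rcases Nat.lt_or_gt_of_ne hne with h | h
  · have := apart_below K i i' h.le θ
    have hp : (0 : ℤ) < 2 ^ i - 2 ^ i' := sub_pos.mpr (pow_lt_pow_right₀ (by norm_num) h)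
    nlinarith [mul_pos (sub_pos.mpr h1) hp]
  · have := apart_above K i i' h.le θ
    have hp : (0 : ℤ) < 2 ^ i' - 2 ^ i := sub_pos.mpr (pow_lt_pow_right₀ (by norm_num) h)
    nlinarith [mul_pos (sub_pos.mpr h2) hp]

/-- a-part above the class `0` for slopes below the first `(0,0)`-slope `U(K+1)`: nonnegative, positive for `i' ≥ 1`. -/
theorem apart_zero_nonneg (K i' : ℕ) (θ : ℤ) (h2 : θ ≤ 2 * V * ((K : ℤ) + 1)) :
    0 ≤ 2 * ah K i' - θ * (2 ^ i' - 1) := by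
  have := apart_above K 0 i' (Nat.zero_le _) θ
  rw [ah_zero] at this
  have hp : (0 : ℤ) ≤ 2 ^ i' - 2 ^ 0 := sub_nonneg.mpr (pow_le_pow_right₀ (by norm_num) (Nat.zero_le _))
  simp only [pow_zero, Nat.cast_zero, add_zero] at this hp ⊢
  nlinarith [mul_nonneg (sub_nonneg.mpr h2) hp]


/-! ### Arithmetic of the c-points -/

/-- the doubled interior c-point cost in closed form. [folklore] -/
theorem two_bq (l : ℕ) : 2 * bq l = 2 * gh l + 2 * V * ((l : ℤ) + 1) * (2 ^ l - 1) - 2 := by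
  unfold bq; ring

/-- the c-point seen from its RIGHT neighbour `P_{0,l+1}`: `2·bq l − 2·gh (l+1) = −U(l+1) − 2`. -/
theorem two_bq_sub_gh_succ (l : ℕ) : 2 * bq l - 2 * gh (l + 1) = -(2 * V * ((l : ℤ) + 1)) - 2 := by
  rw [two_bq, gh_succ]; push_cast; ring

/-- `bq_le_gh` (see the module docstring). [folklore] -/
theorem bq_le_gh (K l : ℕ) (hl : l + 1 ≤ K) : bq l ≤ gh K := by
  obtain ⟨n, hn⟩ := Nat.exists_eq_add_of_le hl
  have h1 := chain_sub_ge sG sG_mono l (n + 1)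
  have e : sG (l + 1) = (l : ℤ) + 1 := by unfold sG; push_cast; ring
  rw [e, show l + (n + 1) = K by omega] at h1
  have hp : (2 : ℤ) ^ (l + 1) ≤ 2 ^ K := pow_le_pow_right₀ (by norm_num) hl
  rw [pow_succ] at hp
  have hV : (0 : ℤ) ≤ V := by unfold V; norm_num
  have hl0 : (0 : ℤ) ≤ (l : ℤ) + 1 := by positivity
  unfold bq gh at *
  have hpl : (0 : ℤ) ≤ 2 ^ l := by positivity
  have h3 : ((l : ℤ) + 1) * V * (2 ^ l - 1) ≤ ((l : ℤ) + 1) * V * (2 ^ K - 2 ^ l) :=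
    mul_le_mul_of_nonneg_left (by linarith) (mul_nonneg hl0 hV)
  linarith

/-- the boundary c-points lose against every supporting functional used below. -/
theorem big_wins (K : ℕ) (θ cv xv : ℤ) (l : ℕ) (hl : l + 1 ≤ K) (hθ0 : 0 ≤ θ) (hθ : θ ≤ 2 * V * (2 * (K : ℤ) + 1) + 8)
    (hcv : cv ≤ 2 * ah K K + 2 * gh K) (hxv : 0 ≤ xv) :
    0 < 2 * big K - cv - θ * (2 * 2 ^ l - xv) := by
  have hp : (2 : ℤ) * 2 ^ l ≤ 2 ^ K := by
    rw [← pow_succ']; exact pow_le_pow_right₀ (by norm_num) hl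
  have hpK : (0 : ℤ) ≤ 2 ^ K := by positivity
  have h1 : θ * (2 * 2 ^ l - xv) ≤ θ * 2 ^ K := by nlinarith
  have h2 : θ * (2 : ℤ) ^ K ≤ (2 * V * (2 * (K : ℤ) + 1) + 8) * 2 ^ K := mul_le_mul_of_nonneg_right hθ hpK
  have ha := ah_nonneg K K
  have hg := gh_nonneg K
  unfold big
  nlinarith

end Summit.ValiantsHypothesis.ValiantsHypothesis.Theorems.LacunarySymmetroidMatrixDescartes.TropicalCensus.SymTwoK
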